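import Literature.NumberTheory.Rogawski1990.ArchCentralLimitFormula   -- ★ p842205: the (L_{U(2,1)}) letter (tokens `archLocal`, `circleDiagonal`); consumer: ★ `ArchCentralLimitCornerJets` (`…of_cornerRegularity_of_values`)
import HarnessLib

/-!
# (A6) CORNER REGULARITY OF THE INVARIANT INTEGRAL OF `U(2,1)` AT THE CENTRE — Harish-Chandra's boundary regularity as ONE named fact, in the socket tokens of the N1 skeleton
# (Harish-Chandra 1975 [H₂] §17; Orloff 1987 p. 198 «the normalized orbital integral is smooth on the closure of any connected component of J′»; Rogawski 1990 §8.4 p. 126)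

Topic `NumberTheory/Rogawski1990`; namespace `Literature.NumberTheory.Rogawski1990`.  ONE `def … : Prop` NAMED FACT (definition lane; net debt +1 BY DESIGN: it is the EXISTENCE half
of the printed-hard letter N1 = `stub_ArchCentralLimitU21`, booked as print row «(A6)» by the ROAD A owner F0P3a-p05 (g13) 2026-09-01T08:54:01Z) (statement only; the one-line wiring theorem `ArchCentralLimitFormulaRankTwo.of_cornerRegularity` rides as ED. 2 of
★ `ArchCentralLimitCornerJets`).  No theorem, no instance, no notation, no `sorry`.  Cell `pub/hodgecm-mathlib`, ENGINE T1 (crux H413 = `stmt-HodgeConjecture-24833`);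
ROAD-Sd, «SdArch» ED. 3; LEAD F0P3a-plan (g10) WORD T9-12 (3)(a) «the (A6) STATEMENT-FIRST hypothesis file … pins the print row the road will book»; typed by F0P3a-p02 (g12), 2026-09-01.

THE PRINT.  Harish-Chandra's invariant integral `F_f^B(b) = Δ(b)·∫_{G∕B} f(g b g⁻¹) dġ` (`B` a Cartan subgroup, `f ∈ C_c^∞(G)`) is smooth on the regular set `B′` and — [HarishChandra1975HARRG1
§17; quoted by Rogawski p. 126 as [H₂] Lemma 17.5 «`ω[ρ(γ)′Δ(γ)Φ_G(γ,f)]` is continuous at `γ₀`»; Orloff 1987 p. 198: «The normalized orbital integral is smooth on the closure of any connected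
component of `J′`»] — its restriction to each connected component of `B′` extends, with all its derivatives, continuously to the closure of the component.  HERE: `G_w = U(σ_w diag α)(ℂ)`
(`archLocal L 3 (diagonal α) w`), `B = T` the diagonal circle torus, `γ₀ = ζ•1` central; in the angle chart `θ ↦ ζe^{iθ}` the components of `T_reg` near the corner `θ = 0` are the six
chambers `C_σ = {θ | θ(σ0) < θ(σ1) < θ(σ2)}`, and `F_Θ = ρ′Δ·Φ_Θ` (the letter's normalisation `ρ′Δ = Δ_HC`, `Φ_Θ(z) = ∫_{G_w} Θ(g·diag z·g⁻¹) dν`, `Θ` ambient-smooth and compactly supported on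
`G_w`, so `g ↦ Θ(g t g⁻¹)` has compact support and `Φ_Θ` is `ν(T_w)·` Harish-Chandra's `∫_{G∕T}`).  THE TYPED FORM (exactly the EXISTENCE socket of ★ `of_chamberExtensions`, order 3 — what the
letter's third-order operator `ω` consumes): for every Borel structure, under the frame guards `α_i ≠ 0`, `σ_wα_i` real, for every Haar right-invariant `ν`, every such `Θ`, every `ζ ∈ S¹`
and every chamber `σ ∈ S₃` there are an OPEN `U ∋ 0` of angle space and `H : ℝ³ → ℂ` with `ContDiffOn ℝ 3 H U` and `H(θ) = F_Θ(ζe^{iθ})` for `θ ∈ U ∩ C_σ`.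
TRUE AS NAMED at every frame: at a DEFINITE place `F_Θ∘chart` is globally smooth (★ `contDiff_integral_comp_conj_circleDiagonal_angles_of_posDef`, F0P3a-p05) and `H := F_Θ∘chart` serves; at an
indefinite place (`G_w ≅ U(2,1)`) it is Harish-Chandra's theorem above (no indefinite guard is needed, none is stated).  No value is asserted (the VALUE half of N1 is the separate ∀-extension
theorem socket of ★ `of_cornerRegularity_of_values`; ★ `lambda8Angle_zero_eq_of_cornerExtensions` shows the value does not depend on the extension).  NOT claimed: `C^∞` up to the corner
(true in print, not needed), uniformity in `Θ`, anything at non-central singular points.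
HONEST LABEL: HC_CM is proved only modulo the printed citations until rung 0 closes; this file STATES one of them (the existence half of N1) and proves nothing about it.

## References
* [HarishChandra1975HARRG1] Harish-Chandra, *Harmonic analysis on real reductive groups. I*, J. Funct. Anal. 19 (1975) 104–204, §17 (Lemma 17.4–17.5).
* [Orloff1987OrbitalIntegrals] J. Orloff, *Orbital integrals on symmetric spaces*, in: Non Commutative Harmonic Analysis and Lie Groups (Marseille-Luminy 1985), LNM 1243 (1987), Introduction p. 198.
* [Rogawski1990] J. D. Rogawski, *Automorphic Representations of Unitary Groups in Three Variables*, Ann. of Math. Stud. 123 (1990), §8.4 pp. 126–127.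
* [Varadarajan1989] V. S. Varadarajan, *An Introduction to Harmonic Analysis on Semisimple Lie Groups* (1989), §6.4 (rank one: `F_f` and its derivative up to the singular point).
-/

noncomputable section

open MeasureTheory Measure Filter Topology Set Function NumberField NumberField.InfinitePlace
open Literature.NumberTheory.Automorphic Literature.NumberTheory.Automorphic.UnitaryGroup
open scoped Matrix MatrixGroups Matrix.Norms.Operator

namespace Literature.NumberTheory.Rogawski1990

section Row

variable (L : Type) [Field L] (α : Fin 3 → L) (w : {w : InfinitePlace L // IsComplex w})

/-- **(A6) HARISH-CHANDRA'S CORNER REGULARITY OF THE INVARIANT INTEGRAL, `U(σ_w diag α)(ℂ)` AT THE CENTRE** [HarishChandra1975HARRG1 §17, L. 17.4–17.5; Orloff1987OrbitalIntegrals p. 198 «The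
normalized orbital integral is smooth on the closure of any connected component of `J′`»; Rogawski1990 §8.4 p. 126 «`ω[ρ(γ)′Δ(γ)Φ_G(γ,f)]` is continuous at `γ₀`» citing [H₂] L. 17.5]: in the angle
chart at the centre `ζ•1` of the diagonal torus of `G_w = archLocal L 3 (diagonal α) w`, for every Borel structure, frame guards `α_i ≠ 0`, `im σ_wα_i = 0`, every Haar right-invariant `ν`, every
ambient smooth `Θ` compactly supported on `G_w`, every `ζ ∈ S¹` and every chamber `C_σ = {θ | θ(σ0) < θ(σ1) < θ(σ2)}`, the restriction of `F_Θ∘chart = (ρ′Δ·Φ_Θ)(ζe^{iθ})` to `C_σ` has a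
`C³` EXTENSION TO A NEIGHBOURHOOD OF THE CORNER: an open `U ∋ 0` and `H` with `ContDiffOn ℝ 3 H U`, `H = F_Θ∘chart` on `U ∩ C_σ` — verbatim the existence socket of ★
`ArchCentralLimitFormulaRankTwo.of_chamberExtensions` ∕ `…of_cornerRegularity_of_values`.  True as named at every frame (definite places: `F_Θ∘chart` is globally smooth); order 3 is what the
letter's `ω = ∏_{i<j}(∂_i − ∂_j)` consumes (print gives `C^∞`).  Printed-hard, floor 2: the EXISTENCE half of N1 `stub_ArchCentralLimitU21`.
[cite: HarishChandra1975HARRG1, §17 Lemma 17.5] [cite: Orloff1987OrbitalIntegrals, Introduction p. 198] [cite: Rogawski1990, §8.4 p. 126] -/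
def ArchCentralLimitCornerRegularity : Prop :=
  ∀ [MeasurableSpace (archLocal L 3 (Matrix.diagonal α) w)] [BorelSpace (archLocal L 3 (Matrix.diagonal α) w)],
    (∀ i, α i ≠ 0) → (∀ i, (w.1.embedding (α i)).im = 0) →
    ∀ (ν : Measure (archLocal L 3 (Matrix.diagonal α) w)) [ν.IsHaarMeasure] [ν.IsMulRightInvariant]
      (Θ : Matrix (Fin 3) (Fin 3) ℂ → ℂ), ContDiff ℝ (⊤ : ℕ∞) Θ →
        HasCompactSupport (fun k : archLocal L 3 (Matrix.diagonal α) w => Θ ((k : GL (Fin 3) ℂ) : Matrix (Fin 3) (Fin 3) ℂ)) →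
        ∀ (ζ : Circle) (σ : Equiv.Perm (Fin 3)),
          ∃ (U : Set (Fin 3 → ℝ)) (H : (Fin 3 → ℝ) → ℂ), IsOpen U ∧ (0 : Fin 3 → ℝ) ∈ U ∧ ContDiffOn ℝ 3 H U ∧
            ∀ θ ∈ U, θ (σ 0) < θ (σ 1) ∧ θ (σ 1) < θ (σ 2) →
              H θ = ((((ζ * Circle.exp (θ 0) : Circle) : ℂ)) * (((ζ * Circle.exp (θ 2) : Circle) : ℂ))⁻¹) * ((1 - (((ζ * Circle.exp (θ 1) : Circle) : ℂ)) * (((ζ * Circle.exp (θ 0) : Circle) : ℂ))⁻¹) * (1 - (((ζ * Circle.exp (θ 2) : Circle) : ℂ)) * (((ζ * Circle.exp (θ 1) : Circle) : ℂ))⁻¹) * (1 - (((ζ * Circle.exp (θ 2) : Circle) : ℂ)) * (((ζ * Circle.exp (θ 0) : Circle) : ℂ))⁻¹)) * (∫ g, Θ (((g * ⟨circleDiagonal 3 (fun k => ζ * Circle.exp (θ k)), circleDiagonal_mem_archLocal_diagonal L 3 α w _⟩ * g⁻¹ : archLocal L 3 (Matrix.diagonal α) w) : GL (Fin 3) ℂ)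 : Matrix (Fin 3) (Fin 3) ℂ) ∂ν)

end Row


end Literature.NumberTheory.Rogawski1990

end
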